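import Summits.ABC.StewartYu.KummerBasisChangeSaturated
import HarnessLib

/-!
# Cell abc-stewartyu, Gen-3 frames: the odd-`p` «± twin» of the Kummer transport under Matveev's
# re-basing — `∏ αⱼ^{φⱼ} = ±γ^q ⇒ q ∣ φ` survives a change of basis inside a saturated lattice

`Summits/ABC/StewartYu/KummerBasisChangeSaturatedPM.lean` — cell `abc-stewartyu` (HOME
`run/shared/lean/pub/abc-stewartyu/`), route `PadicPrimesKummerThird`, crux `Y07Odd` (stmt-ABC-19658);
seat p4 (g3), engine-support seat; sequel of p3's `KummerBasisChange.lean` /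
`KummerBasisChangeSaturated.lean` (`Summit.ABC.StewartYu.KummerBasisChange.mulIndep_and_kummer_of_chars`,
p462003).  Theorems only, pure lattice algebra over a field `K` (place-free).  Statement of the headline =
planner g7's sketch `HOME/plan/m3/KummerPMSketch.statement.lean` (INTERFACE RULE, STATUS
2026-08-26T19:37:58Z; the «GAP (odd p): ± twin of the Kummer transport» of HOME/plan/m3/ZE-INTERFACE.md §G.4).

At odd `p` the `q = 2` Kummer condition of the Gen-3 engine text `GenThreeEngineOdd` is SIGNED
(`¬ IsSquare (± ∏_{j∈T} αⱼ)`; in `ℤ`-exponent currency: `∏ αⱼ^{φⱼ} = ±γ^q ⇒ q ∣ φⱼ`), because `−1` is the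
torsion of `ℚˣ` and the `2`-descent meets both signs.  Matveev's step replaces the generators `αⱼ` by
`θᵢ = ∏ⱼ αⱼ^{(y·M)ᵢⱼ}` where `M` is a `ℤ`-basis of the (saturated) character lattice `H.chars` of the zero
estimate's obstruction subgroup and `y` spans `ℤʳ` (Mahler re-basing after the lattice lever).  This file
transports the SIGNED condition through that step:

* `dvd_of_dvd_combination` — the lattice core: for `ℤ`-independent rows `Zᵢ` with `q`-saturated span,
  `q ∣ ∑ᵢ κᵢ Zᵢⱼ (∀ j) ⇒ q ∣ κᵢ (∀ i)`;
* `kummerPred_basisChange` — the Kummer transport for an ARBITRARY target predicate `P` on `K`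
  (`P(∏ αⱼ^{φⱼ}) ⇒ q ∣ φ` in, `P(∏ θᵢ^{κᵢ}) ⇒ q ∣ κ` out): the proof of p3's `kummer_basisChange` never looks
  at the right-hand side `γ^q`, only at the exponent vector;
* `kummerPM_basisChange` — the instance `P x := ∃ γ, x = γ^q ∨ x = −γ^q`;
* `mulIndep_and_kummerPM_of_chars` — HEADLINE (planner's sketch verbatim): independence and the signed
  `q`-Kummer condition of the `θᵢ` from those of the `αⱼ`, for the zero estimate's `(H, M)` and any
  re-basing `y` with `span(range y) = ⊤`.

References: Yu. V. Nesterenko, LNM 1819 (2003), Prop. 2.6, Cor. 4.5, §5.1; K. Yu, Acta Math. 211 (2013),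
§2 ("basic hypothesis": `[K(α₁^{1/q},…,αᵣ^{1/q}) : K] = qʳ`), §5.
-/

open Finset
open Literature.NumberTheory.Transcendental
open Literature.NumberTheory.Transcendental.GaGm

namespace Summit.ABC.StewartYu.KummerBasisChange

variable {K : Type*} [Field K] {m r ν : ℕ}

/-- **Lattice core of the Kummer transport**: for `ℤ`-independent rows `Zᵢ ∈ ℤᵐ` whose span `Λ` is
`q`-saturated (`q·v ∈ Λ ⇒ v ∈ Λ`), an exponent vector `κ ∈ ℤ^ν` with `q ∣ ∑ᵢ κᵢ Zᵢⱼ` for every `j` is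
itself divisible by `q`. [cite: Nesterenko2003, Cor 4.5] -/
theorem dvd_of_dvd_combination (q : ℕ) (Z : Fin ν → Fin m → ℤ) (hZ : LinearIndependent ℤ Z)
    (hsat : ∀ v : Fin m → ℤ, (q : ℤ) • v ∈ Submodule.span ℤ (Set.range Z) →
      v ∈ Submodule.span ℤ (Set.range Z))
    (κ : Fin ν → ℤ) (hdiv : ∀ j, (q : ℤ) ∣ ∑ i, κ i * Z i j) : ∀ i, (q : ℤ) ∣ κ i := by
  classical
  choose w hw using hdiv
  -- `q • w = φ := ∑ κᵢ Zᵢ ∈ Λ`, hence `w ∈ Λ` by saturation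
  have hφmem : (fun j => ∑ i, κ i * Z i j) ∈ Submodule.span ℤ (Set.range Z) := by
    have : (fun j => ∑ i, κ i * Z i j) = ∑ i, κ i • Z i := by
      funext j; simp [Finset.sum_apply]
    rw [this]
    exact Submodule.sum_mem _ fun i _ => Submodule.smul_mem _ _ (Submodule.subset_span ⟨i, rfl⟩)
  have hqw : (q : ℤ) • (fun j => w j) = fun j => ∑ i, κ i * Z i j := by
    funext j; simp [hw j]
  have hwmem : (fun j => w j) ∈ Submodule.span ℤ (Set.range Z) := hsat _ (by rw [hqw]; exact hφmem)
  obtain ⟨κ', hκ'⟩ := (Submodule.mem_span_range_iff_exists_fun ℤ).mp hwmem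
  -- compare coefficients: `κ = q κ'`
  have hzero : (fun i => κ i - (q : ℤ) * κ' i) = 0 := by
    refine eq_zero_of_sum_mul_rows_eq_zero Z hZ _ fun j => ?_
    have h1 : ∑ i, κ' i * Z i j = w j := by
      have := congrFun hκ' j
      simpa [Finset.sum_apply] using this
    have h2 : ∑ i, κ i * Z i j = (q : ℤ) * w j := hw j
    calc ∑ i, (κ i - (q : ℤ) * κ' i) * Z i j
        = ∑ i, κ i * Z i j - (q : ℤ) * ∑ i, κ' i * Z i j := by
          rw [Finset.mul_sum, ← Finset.sum_sub_distrib]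
          refine Finset.sum_congr rfl fun i _ => ?_; ring
      _ = 0 := by rw [h2, h1, sub_self]
  intro i
  have := congrFun hzero i
  simp only [Pi.zero_apply, sub_eq_zero] at this
  exact ⟨κ' i, this⟩

/-- **Kummer transport for an arbitrary target predicate**: if `P (∏ αⱼ^{φⱼ}) ⇒ q ∣ φⱼ` for all
`φ ∈ ℤᵐ`, the rows `Zᵢ` are `ℤ`-independent with `q`-saturated span, and `θᵢ = ∏ αⱼ^{Zᵢⱼ}`, then
`P (∏ θᵢ^{κᵢ}) ⇒ q ∣ κᵢ`.  (`P x := ∃ γ, x = γ^q` is p3's `kummer_basisChange`; the signed predicate is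
`kummerPM_basisChange`.) [cite: Nesterenko2003, Cor 4.5] -/
theorem kummerPred_basisChange (q : ℕ) (P : K → Prop) (α : Fin m → K) (hα : ∀ j, α j ≠ 0)
    (hK : ∀ φ : Fin m → ℤ, P (∏ j, α j ^ φ j) → ∀ j, (q : ℤ) ∣ φ j)
    (Z : Fin ν → Fin m → ℤ) (hZ : LinearIndependent ℤ Z)
    (hsat : ∀ v : Fin m → ℤ, (q : ℤ) • v ∈ Submodule.span ℤ (Set.range Z) →
      v ∈ Submodule.span ℤ (Set.range Z))
    (θ : Fin ν → K) (hθ : ∀ i, θ i = ∏ j, α j ^ Z i j) :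
    ∀ κ : Fin ν → ℤ, P (∏ i, θ i ^ κ i) → ∀ i, (q : ℤ) ∣ κ i := by
  intro κ hκ
  rw [prod_zpow_basisChange α hα Z θ hθ κ] at hκ
  exact dvd_of_dvd_combination q Z hZ hsat κ (hK _ hκ)

/-- **The signed `q`-Kummer condition survives a change of basis inside a `q`-saturated lattice** (odd-`p`
currency, `q = 2`, both signs): `∏ αⱼ^{φⱼ} = ±γ^q ⇒ q ∣ φⱼ` in, `∏ θᵢ^{κᵢ} = ±γ^q ⇒ q ∣ κᵢ` out, for
`θᵢ = ∏ αⱼ^{Zᵢⱼ}` with `ℤ`-independent rows of `q`-saturated span. [cite: Nesterenko2003, Cor 4.5] -/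
theorem kummerPM_basisChange (q : ℕ) (α : Fin m → K) (hα : ∀ j, α j ≠ 0)
    (hK : ∀ φ : Fin m → ℤ, (∃ γ : K, ∏ j, α j ^ φ j = γ ^ q ∨ ∏ j, α j ^ φ j = -γ ^ q) →
      ∀ j, (q : ℤ) ∣ φ j)
    (Z : Fin ν → Fin m → ℤ) (hZ : LinearIndependent ℤ Z)
    (hsat : ∀ v : Fin m → ℤ, (q : ℤ) • v ∈ Submodule.span ℤ (Set.range Z) →
      v ∈ Submodule.span ℤ (Set.range Z))
    (θ : Fin ν → K) (hθ : ∀ i, θ i = ∏ j, α j ^ Z i j) :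
    ∀ κ : Fin ν → ℤ, (∃ γ : K, ∏ i, θ i ^ κ i = γ ^ q ∨ ∏ i, θ i ^ κ i = -γ ^ q) →
      ∀ i, (q : ℤ) ∣ κ i :=
  kummerPred_basisChange q (fun x => ∃ γ : K, x = γ ^ q ∨ x = -γ ^ q) α hα hK Z hZ hsat θ hθ

/-- **HEADLINE — the odd-`p` ± twin of `mulIndep_and_kummer_of_chars`** (planner g7's sketch statement
verbatim): for the zero estimate's obstruction subgroup `H` with basis `M` of `H.chars` (rows independent),
a re-basing family `y` spanning `ℤʳ`, nonzero `αⱼ ∈ K` multiplicatively independent and SIGNED `q`-Kummer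
(`∏ αⱼ^{φⱼ} = ±γ^q ⇒ q ∣ φ`, `q ≥ 1`), and `θᵢ = ∏ⱼ αⱼ^{∑ₖ yᵢₖ Mₖⱼ}`: the `θᵢ` are multiplicatively
independent and signed `q`-Kummer. [cite: Nesterenko2003, Prop 2.6, Cor 4.5] -/
theorem mulIndep_and_kummerPM_of_chars (q : ℕ) (hq : 1 ≤ q) (α : Fin m → K) (hα : ∀ j, α j ≠ 0)
    (hind : ∀ φ : Fin m → ℤ, ∏ j, α j ^ φ j = 1 → φ = 0)
    (hK : ∀ φ : Fin m → ℤ, (∃ γ : K, ∏ j, α j ^ φ j = γ ^ q ∨ ∏ j, α j ^ φ j = -γ ^ q) →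
      ∀ j, (q : ℤ) ∣ φ j)
    (H : ConnAlgSubgroup m) (M : Fin r → Fin m → ℤ) (hM : LinearIndependent ℤ M)
    (hchars : H.chars = AddSubgroup.closure (Set.range M))
    (y : Fin r → Fin r → ℤ) (hy : Submodule.span ℤ (Set.range y) = ⊤)
    (θ : Fin r → K) (hθ : ∀ i, θ i = ∏ j, α j ^ (∑ k, y i k • M k) j) :
    (∀ μ : Fin r → ℤ, ∏ i, θ i ^ μ i = 1 → μ = 0) ∧
      ∀ κ : Fin r → ℤ, (∃ γ : K, ∏ i, θ i ^ κ i = γ ^ q ∨ ∏ i, θ i ^ κ i = -γ ^ q) →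
        ∀ i, (q : ℤ) ∣ κ i := by
  have hZ := linearIndependent_rows_combination M hM y hy
  refine ⟨mulIndep_basisChange α hα hind _ hZ θ hθ, ?_⟩
  refine kummerPM_basisChange q α hα hK _ hZ (fun v hv => ?_) θ hθ
  rw [span_rows_combination_eq M y hy] at hv ⊢
  exact qSaturated_span_of_chars H M hchars (by exact_mod_cast (show q ≠ 0 by omega)) v hv

end Summit.ABC.StewartYu.KummerBasisChange
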